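import Literature.NumberTheory.Sieve.RamanujanSum
import HarnessLib

/-!
# The discrete circle identity on `ℤ/N₀` for `d₁n₁ ± d₂n₂ = d₃n₃` with a common shift

Topic `Literature/NumberTheory/Sieve`; a PROVED tool file: the counting device of the circle
method for weighted (e.g. friable) solutions of a ternary linear equation, as in [Harper2016, §5]
(friable solutions of `a + b = c` counted by `∫₀¹ F(θ) G(θ) conj K(θ) dθ`), here for
`d₁n₁ + σd₂n₂ = d₃n₃` with integer dilations `d_i`, a sign `σ = ±1`, and in the discrete form on
the `N₀` sample points `r/N₀ + t`, `0 ≤ r < N₀`, used in the tree (cf. `Endgame.circle_identity`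
in `SmoothEndgameCircle.lean`: the case `a + b = c`, `t = 0`).

For dilations `d₁, d₂, d₃ ∈ ℕ`, a sign `σ = ±1`, finitely supported weights `w_i` on `n ≤ B_i`,
the exponential sums `V_i(θ) = ∑_n w_i(n) e(nθ)` and `d₁B₁ + d₂B₂ + d₃B₃ < N₀` (no wrap-around
modulo `N₀`), for EVERY real shift `t`

`∑_{0 ≤ r < N₀} V₁(d₁(r/N₀ + t)) V₂(σd₂(r/N₀ + t)) conj V₃(d₃(r/N₀ + t))`
`= N₀ ∑_{n₁, n₂, n₃ : d₁n₁ + σd₂n₂ = d₃n₃} w₁(n₁) w₂(n₂) conj w₃(n₃)`;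

in particular the left side does not depend on `t`. Proof: expand, combine the three phases into
`e(m(r/N₀ + t))` with `m = d₁n₁ + σd₂n₂ − d₃n₃ ∈ ℤ` (`conj e(x) = e(−x)`), use the shifted
orthogonality `∑_{r<N₀} e(m(r/N₀ + t)) = e(mt) N₀ [N₀ ∣ m]` (`sum_range_fourierChar_int_mul_add`,
from `RamanujanSum.sum_range_fourierChar_div`), and `|m| < N₀`, so `N₀ ∣ m ↔ m = 0`, where
`e(mt) = 1`.

* `ternary_circle_identity_finset`: weights on arbitrary finite sets `S_i ⊆ [0, B_i]`;
* `ternary_circle_identity`: `S_i = [1, B_i]`;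
* `ternary_circle_identity_zero` (`t = 0`), `ternary_circle_identity_add` (`σ = 1`, counting
  condition `d₁n₁ + d₂n₂ = d₃n₃` in `ℕ`), `ternary_circle_identity_sub` (`σ = −1`, condition
  `d₁n₁ = d₂n₂ + d₃n₃` in `ℕ`).

## References

* A. J. Harper, *Minor arcs, mean values, and restriction theory for exponential sums over smooth
  numbers*, Compositio Math. 152 (2016) 1121–1158, §5 [Harper2016].
* H. L. Montgomery, R. C. Vaughan, *Multiplicative Number Theory I* (2007), §4.1, Thm 4.1
  eq. (4.6) (orthogonality of the additive characters modulo `q`) [MontgomeryVaughan2007].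
-/

noncomputable section

open Finset
open scoped FourierTransform ComplexConjugate

namespace Literature.NumberTheory.Sieve

namespace TernaryCircle

open RamanujanSum

/-! ### Shifted orthogonality on `ℤ/q` -/

/-- **Shifted orthogonality**: `∑_{0 ≤ r < q} e(m(r/q + t)) = e(mt) · q [q ∣ m]` for `q ≠ 0`,
`m ∈ ℤ`, `t ∈ ℝ`. [cite: MontgomeryVaughan2007, §4.1 Thm 4.1 eq. (4.6)] -/
theorem sum_range_fourierChar_int_mul_add {q : ℕ} (hq : q ≠ 0) (m : ℤ) (t : ℝ) :
    ∑ r ∈ range q, (𝐞 ((m : ℝ) * ((r : ℝ) / q + t)) : ℂ) =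
      (𝐞 ((m : ℝ) * t) : ℂ) * if (q : ℤ) ∣ m then (q : ℂ) else 0 := by
  rw [← sum_range_fourierChar_div hq m, Finset.mul_sum]
  refine Finset.sum_congr rfl fun r _ => ?_
  rw [← Circle.coe_mul, ← AddChar.map_add_eq_mul]
  congr 2
  ring

/-- **No wrap-around**: if moreover `|m| < q` then `∑_{0 ≤ r < q} e(m(r/q + t)) = q [m = 0]`
(`q ∣ m ↔ m = 0`, and the shift phase `e(mt)` is `1` at `m = 0`). [folklore] -/
theorem sum_range_fourierChar_int_mul_add_of_abs_lt {q : ℕ} (hq : q ≠ 0) {m : ℤ}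
    (hm : |m| < q) (t : ℝ) :
    ∑ r ∈ range q, (𝐞 ((m : ℝ) * ((r : ℝ) / q + t)) : ℂ) = if m = 0 then (q : ℂ) else 0 := by
  rw [sum_range_fourierChar_int_mul_add hq m t]
  by_cases h0 : m = 0
  · subst h0
    simp
  · rw [if_neg h0, if_neg fun hdvd => h0 (Int.eq_zero_of_abs_lt_dvd hdvd hm), mul_zero]

/-! ### The three phases and the size of `m = d₁n₁ + σd₂n₂ − d₃n₃` -/

/-- The three phases combine: `e(n₁·d₁θ) e(n₂·σd₂θ) conj e(n₃·d₃θ) = e(mθ)` with the integer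
`m = d₁n₁ + σd₂n₂ − d₃n₃` (`conj e(x) = e(x)⁻¹ = e(−x)`). [folklore] -/
theorem fourierChar_triple (n₁ n₂ n₃ d₁ d₂ d₃ : ℕ) (σ : ℤ) (θ : ℝ) :
    (𝐞 ((n₁ : ℝ) * ((d₁ : ℝ) * θ)) : ℂ) * (𝐞 ((n₂ : ℝ) * ((σ * d₂ : ℝ) * θ)) : ℂ) *
        conj (𝐞 ((n₃ : ℝ) * ((d₃ : ℝ) * θ)) : ℂ) =
      (𝐞 ((((d₁ * n₁ : ℤ) + σ * (d₂ * n₂) - d₃ * n₃ : ℤ) : ℝ) * θ) : ℂ) := by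
  rw [← Circle.coe_inv_eq_conj, ← AddChar.map_neg_eq_inv, ← Circle.coe_mul, ← Circle.coe_mul,
    ← AddChar.map_add_eq_mul, ← AddChar.map_add_eq_mul]
  congr 2
  push_cast
  ring

/-- The size bound behind "no wrap-around": for `σ = ±1`, `n_i ≤ B_i` and
`d₁B₁ + d₂B₂ + d₃B₃ < N₀` one has `|d₁n₁ + σd₂n₂ − d₃n₃| < N₀`. [folklore] -/
theorem abs_lt_of_noWrap {N₀ B₁ B₂ B₃ d₁ d₂ d₃ n₁ n₂ n₃ : ℕ} {σ : ℤ} (hσ : σ = 1 ∨ σ = -1)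
    (hwrap : d₁ * B₁ + d₂ * B₂ + d₃ * B₃ < N₀) (h₁ : n₁ ≤ B₁) (h₂ : n₂ ≤ B₂) (h₃ : n₃ ≤ B₃) :
    |(d₁ * n₁ : ℤ) + σ * (d₂ * n₂) - d₃ * n₃| < N₀ := by
  have e₁ : (d₁ : ℤ) * n₁ ≤ d₁ * B₁ := by exact_mod_cast Nat.mul_le_mul_left d₁ h₁
  have e₂ : (d₂ : ℤ) * n₂ ≤ d₂ * B₂ := by exact_mod_cast Nat.mul_le_mul_left d₂ h₂
  have e₃ : (d₃ : ℤ) * n₃ ≤ d₃ * B₃ := by exact_mod_cast Nat.mul_le_mul_left d₃ h₃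
  have hw : (d₁ : ℤ) * B₁ + d₂ * B₂ + d₃ * B₃ < N₀ := by exact_mod_cast hwrap
  have p₁ : (0 : ℤ) ≤ d₁ * n₁ := by positivity
  have p₂ : (0 : ℤ) ≤ d₂ * n₂ := by positivity
  have p₃ : (0 : ℤ) ≤ d₃ * n₃ := by positivity
  rw [abs_lt]
  rcases hσ with rfl | rfl <;> constructor <;> linarith

end TernaryCircle

open TernaryCircle

/-! ### The circle identity -/

/-- **The discrete circle identity for `d₁n₁ + σd₂n₂ = d₃n₃` with dilations and a common shift,
weights on arbitrary finite sets.** For `σ = ±1`, finite sets `S_i` of naturals `≤ B_i` with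
`d₁B₁ + d₂B₂ + d₃B₃ < N₀`, weights `w_i` and every real `t`:
`∑_{r<N₀} V₁(d₁(r/N₀+t)) V₂(σd₂(r/N₀+t)) conj V₃(d₃(r/N₀+t)) = N₀ ∑_{d₁n₁+σd₂n₂=d₃n₃} w₁ w₂ conj w₃`
(`V_i(θ) = ∑_{n ∈ S_i} w_i(n) e(nθ)`); the left side is independent of the shift `t`.
[cite: Harper2016, §5] [cite: MontgomeryVaughan2007, §4.1 Thm 4.1 eq. (4.6)] -/
theorem ternary_circle_identity_finset {N₀ : ℕ} (hN : N₀ ≠ 0) {S₁ S₂ S₃ : Finset ℕ}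
    {B₁ B₂ B₃ : ℕ} (hS₁ : ∀ n ∈ S₁, n ≤ B₁) (hS₂ : ∀ n ∈ S₂, n ≤ B₂) (hS₃ : ∀ n ∈ S₃, n ≤ B₃)
    (d₁ d₂ d₃ : ℕ) (σ : ℤ) (hσ : σ = 1 ∨ σ = -1) (hwrap : d₁ * B₁ + d₂ * B₂ + d₃ * B₃ < N₀)
    (w₁ w₂ w₃ : ℕ → ℂ) (t : ℝ) :
    ∑ r ∈ range N₀,
        (∑ n ∈ S₁, w₁ n * (𝐞 ((n : ℝ) * ((d₁ : ℝ) * ((r : ℝ) / N₀ + t))) : ℂ)) *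
        (∑ n ∈ S₂, w₂ n * (𝐞 ((n : ℝ) * ((σ * d₂ : ℝ) * ((r : ℝ) / N₀ + t))) : ℂ)) *
        conj (∑ n ∈ S₃, w₃ n * (𝐞 ((n : ℝ) * ((d₃ : ℝ) * ((r : ℝ) / N₀ + t))) : ℂ)) =
      (N₀ : ℂ) * ∑ n₁ ∈ S₁, ∑ n₂ ∈ S₂, ∑ n₃ ∈ S₃,
        if (d₁ * n₁ : ℤ) + σ * (d₂ * n₂) = d₃ * n₃ then w₁ n₁ * w₂ n₂ * conj (w₃ n₃) else 0 := by
  -- expand the triple product for each `r` and combine the phases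
  have hexp : ∀ r : ℕ,
      (∑ n ∈ S₁, w₁ n * (𝐞 ((n : ℝ) * ((d₁ : ℝ) * ((r : ℝ) / N₀ + t))) : ℂ)) *
        (∑ n ∈ S₂, w₂ n * (𝐞 ((n : ℝ) * ((σ * d₂ : ℝ) * ((r : ℝ) / N₀ + t))) : ℂ)) *
        conj (∑ n ∈ S₃, w₃ n * (𝐞 ((n : ℝ) * ((d₃ : ℝ) * ((r : ℝ) / N₀ + t))) : ℂ)) =
      ∑ n₁ ∈ S₁, ∑ n₂ ∈ S₂, ∑ n₃ ∈ S₃, w₁ n₁ * w₂ n₂ * conj (w₃ n₃) *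
        (𝐞 ((((d₁ * n₁ : ℤ) + σ * (d₂ * n₂) - d₃ * n₃ : ℤ) : ℝ) * ((r : ℝ) / N₀ + t)) : ℂ) := by
    intro r
    rw [map_sum, Finset.sum_mul_sum, Finset.sum_mul]
    refine Finset.sum_congr rfl fun n₁ _ => ?_
    rw [Finset.sum_mul]
    refine Finset.sum_congr rfl fun n₂ _ => ?_
    rw [Finset.mul_sum]
    refine Finset.sum_congr rfl fun n₃ _ => ?_
    rw [map_mul (starRingEnd ℂ), ← fourierChar_triple n₁ n₂ n₃ d₁ d₂ d₃ σ]
    ring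
  -- swap the sum over `r` inside and evaluate it
  rw [Finset.sum_congr rfl fun r _ => hexp r, Finset.sum_comm, Finset.mul_sum]
  refine Finset.sum_congr rfl fun n₁ hn₁ => ?_
  rw [Finset.sum_comm, Finset.mul_sum]
  refine Finset.sum_congr rfl fun n₂ hn₂ => ?_
  rw [Finset.sum_comm, Finset.mul_sum]
  refine Finset.sum_congr rfl fun n₃ hn₃ => ?_
  rw [← Finset.mul_sum, sum_range_fourierChar_int_mul_add_of_abs_lt hN
    (abs_lt_of_noWrap hσ hwrap (hS₁ n₁ hn₁) (hS₂ n₂ hn₂) (hS₃ n₃ hn₃)) t]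
  by_cases hm : (d₁ * n₁ : ℤ) + σ * (d₂ * n₂) = d₃ * n₃
  · rw [if_pos hm, if_pos (sub_eq_zero.mpr hm)]
    ring
  · rw [if_neg hm, if_neg fun h => hm (sub_eq_zero.mp h), mul_zero, mul_zero]

/-- **The discrete circle identity for `d₁n₁ + σd₂n₂ = d₃n₃` with dilations and a common shift.**
For `N₀ ≠ 0`, `σ = ±1`, `d₁B₁ + d₂B₂ + d₃B₃ < N₀`, weights `w_i` on `1 ≤ n ≤ B_i` and every real
`t`, with `V_i(θ) = ∑_{n=1}^{B_i} w_i(n) e(nθ)`: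
`∑_{r<N₀} V₁(d₁(r/N₀+t)) V₂(σd₂(r/N₀+t)) conj V₃(d₃(r/N₀+t)) = N₀ ∑_{d₁n₁+σd₂n₂=d₃n₃} w₁ w₂ conj w₃`.
Weights supported on subsets `S_i ⊆ [1, B_i]` are covered by extending them by `0` (or by
`ternary_circle_identity_finset`). [cite: Harper2016, §5]
[cite: MontgomeryVaughan2007, §4.1 Thm 4.1 eq. (4.6)] -/
theorem ternary_circle_identity {N₀ : ℕ} (hN : N₀ ≠ 0) (B₁ B₂ B₃ d₁ d₂ d₃ : ℕ) (σ : ℤ) (hσ : σ = 1 ∨ σ = -1)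
    (hwrap : d₁ * B₁ + d₂ * B₂ + d₃ * B₃ < N₀) (w₁ w₂ w₃ : ℕ → ℂ) (t : ℝ) :
    ∑ r ∈ Finset.range N₀,
        (∑ n ∈ Finset.Icc 1 B₁, w₁ n * (𝐞 ((n : ℝ) * ((d₁ : ℝ) * ((r : ℝ) / N₀ + t))) : ℂ)) *
        (∑ n ∈ Finset.Icc 1 B₂, w₂ n * (𝐞 ((n : ℝ) * ((σ * d₂ : ℝ) * ((r : ℝ) / N₀ + t))) : ℂ)) *
        starRingEnd ℂ (∑ n ∈ Finset.Icc 1 B₃, w₃ n * (𝐞 ((n : ℝ) * ((d₃ : ℝ) * ((r : ℝ) / N₀ + t))) : ℂ)) =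
      (N₀ : ℂ) * ∑ n₁ ∈ Finset.Icc 1 B₁, ∑ n₂ ∈ Finset.Icc 1 B₂, ∑ n₃ ∈ Finset.Icc 1 B₃,
        if (d₁ * n₁ : ℤ) + σ * (d₂ * n₂) = d₃ * n₃ then w₁ n₁ * w₂ n₂ * starRingEnd ℂ (w₃ n₃) else 0 :=
  ternary_circle_identity_finset hN (fun _ h => (Finset.mem_Icc.mp h).2)
    (fun _ h => (Finset.mem_Icc.mp h).2) (fun _ h => (Finset.mem_Icc.mp h).2) d₁ d₂ d₃ σ hσ hwrap
    w₁ w₂ w₃ t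

/-! ### Corollaries: no shift, and the two signs -/

/-- The circle identity at the unshifted sample points `r/N₀` (`t = 0` in
`ternary_circle_identity`). [cite: Harper2016, §5] -/
theorem ternary_circle_identity_zero {N₀ : ℕ} (hN : N₀ ≠ 0) (B₁ B₂ B₃ d₁ d₂ d₃ : ℕ) (σ : ℤ)
    (hσ : σ = 1 ∨ σ = -1) (hwrap : d₁ * B₁ + d₂ * B₂ + d₃ * B₃ < N₀) (w₁ w₂ w₃ : ℕ → ℂ) :
    ∑ r ∈ Finset.range N₀,
        (∑ n ∈ Finset.Icc 1 B₁, w₁ n * (𝐞 ((n : ℝ) * ((d₁ : ℝ) * ((r : ℝ) / N₀))) : ℂ)) *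
        (∑ n ∈ Finset.Icc 1 B₂, w₂ n * (𝐞 ((n : ℝ) * ((σ * d₂ : ℝ) * ((r : ℝ) / N₀))) : ℂ)) *
        starRingEnd ℂ (∑ n ∈ Finset.Icc 1 B₃, w₃ n * (𝐞 ((n : ℝ) * ((d₃ : ℝ) * ((r : ℝ) / N₀))) : ℂ)) =
      (N₀ : ℂ) * ∑ n₁ ∈ Finset.Icc 1 B₁, ∑ n₂ ∈ Finset.Icc 1 B₂, ∑ n₃ ∈ Finset.Icc 1 B₃,
        if (d₁ * n₁ : ℤ) + σ * (d₂ * n₂) = d₃ * n₃ then w₁ n₁ * w₂ n₂ * starRingEnd ℂ (w₃ n₃) else 0 := by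
  simpa only [add_zero] using ternary_circle_identity hN B₁ B₂ B₃ d₁ d₂ d₃ σ hσ hwrap w₁ w₂ w₃ 0

/-- The sign `σ = 1`: solutions of `d₁n₁ + d₂n₂ = d₃n₃` (counting condition in `ℕ`), weights on
finite sets `S_i` of naturals `≤ B_i`, any shift `t`. [cite: Harper2016, §5] -/
theorem ternary_circle_identity_add {N₀ : ℕ} (hN : N₀ ≠ 0) {S₁ S₂ S₃ : Finset ℕ}
    {B₁ B₂ B₃ : ℕ} (hS₁ : ∀ n ∈ S₁, n ≤ B₁) (hS₂ : ∀ n ∈ S₂, n ≤ B₂) (hS₃ : ∀ n ∈ S₃, n ≤ B₃)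
    (d₁ d₂ d₃ : ℕ) (hwrap : d₁ * B₁ + d₂ * B₂ + d₃ * B₃ < N₀) (w₁ w₂ w₃ : ℕ → ℂ) (t : ℝ) :
    ∑ r ∈ range N₀,
        (∑ n ∈ S₁, w₁ n * (𝐞 ((n : ℝ) * ((d₁ : ℝ) * ((r : ℝ) / N₀ + t))) : ℂ)) *
        (∑ n ∈ S₂, w₂ n * (𝐞 ((n : ℝ) * ((d₂ : ℝ) * ((r : ℝ) / N₀ + t))) : ℂ)) *
        conj (∑ n ∈ S₃, w₃ n * (𝐞 ((n : ℝ) * ((d₃ : ℝ) * ((r : ℝ) / N₀ + t))) : ℂ)) =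
      (N₀ : ℂ) * ∑ n₁ ∈ S₁, ∑ n₂ ∈ S₂, ∑ n₃ ∈ S₃,
        if d₁ * n₁ + d₂ * n₂ = d₃ * n₃ then w₁ n₁ * w₂ n₂ * conj (w₃ n₃) else 0 := by
  have h := ternary_circle_identity_finset hN hS₁ hS₂ hS₃ d₁ d₂ d₃ 1 (Or.inl rfl) hwrap w₁ w₂ w₃ t
  simp only [Int.cast_one, one_mul] at h
  rw [h]
  refine congrArg _ (Finset.sum_congr rfl fun n₁ _ => Finset.sum_congr rfl fun n₂ _ =>
    Finset.sum_congr rfl fun n₃ _ => if_congr ?_ rfl rfl)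
  norm_cast

/-- The sign `σ = -1`: solutions of `d₁n₁ = d₂n₂ + d₃n₃` (counting condition in `ℕ`), weights on
finite sets `S_i` of naturals `≤ B_i`, any shift `t`. [cite: Harper2016, §5] -/
theorem ternary_circle_identity_sub {N₀ : ℕ} (hN : N₀ ≠ 0) {S₁ S₂ S₃ : Finset ℕ}
    {B₁ B₂ B₃ : ℕ} (hS₁ : ∀ n ∈ S₁, n ≤ B₁) (hS₂ : ∀ n ∈ S₂, n ≤ B₂) (hS₃ : ∀ n ∈ S₃, n ≤ B₃)
    (d₁ d₂ d₃ : ℕ) (hwrap : d₁ * B₁ + d₂ * B₂ + d₃ * B₃ < N₀) (w₁ w₂ w₃ : ℕ → ℂ) (t : ℝ) :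
    ∑ r ∈ range N₀,
        (∑ n ∈ S₁, w₁ n * (𝐞 ((n : ℝ) * ((d₁ : ℝ) * ((r : ℝ) / N₀ + t))) : ℂ)) *
        (∑ n ∈ S₂, w₂ n * (𝐞 ((n : ℝ) * (-(d₂ : ℝ) * ((r : ℝ) / N₀ + t))) : ℂ)) *
        conj (∑ n ∈ S₃, w₃ n * (𝐞 ((n : ℝ) * ((d₃ : ℝ) * ((r : ℝ) / N₀ + t))) : ℂ)) =
      (N₀ : ℂ) * ∑ n₁ ∈ S₁, ∑ n₂ ∈ S₂, ∑ n₃ ∈ S₃,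
        if d₁ * n₁ = d₂ * n₂ + d₃ * n₃ then w₁ n₁ * w₂ n₂ * conj (w₃ n₃) else 0 := by
  have h := ternary_circle_identity_finset hN hS₁ hS₂ hS₃ d₁ d₂ d₃ (-1) (Or.inr rfl) hwrap
    w₁ w₂ w₃ t
  simp only [Int.cast_neg, Int.cast_one, neg_one_mul] at h
  rw [h]
  refine congrArg _ (Finset.sum_congr rfl fun n₁ _ => Finset.sum_congr rfl fun n₂ _ =>
    Finset.sum_congr rfl fun n₃ _ => if_congr ?_ rfl rfl)
  rw [← Nat.cast_inj (R := ℤ)]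
  push_cast
  constructor <;> intro h <;> linarith

end Literature.NumberTheory.Sieve
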